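import Mathlib
import HarnessLib
import Summits.HubbardSuperconductivity.HubbardSuperconductivity.Theorems.FunctionFieldCertificateWindowInfraredBoundReductions
import Summits.HubbardSuperconductivity.HubbardSuperconductivity.Theorems.FunctionFieldCertificateWindowInfraredBoundEngines
import Summits.HubbardSuperconductivity.HubbardSuperconductivity.Theorems.FunctionFieldCertificateMesoscopicPairOrderNecessity

/-!
# Crux-strategist r1 sketch — crux `WindowInfraredBound` (stmt-HubbardSuperconductivity-1089):
# typed companions of STRATEGY-CENSUS-r1.md (redirect strategist, second opinion)

Kernel-checked companions of the r1 census (nothing here is filed as a route item or split; reasons in the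
census). Vocabulary: `wib_iff_pairStructureFactor` (crux in tree vocabulary, `Iff.rfl`).

* §A `WibAt U δ` — the crux body at one point (same body as `SketchStrategistS1.WibAt`, restated here so
  that this file imports only Theorems), `wib_iff_forall_wibAt`.
* §B NEGATION lens, pointwise refuter interface: `PairPeakAt U δ` (macroscopic `d`-wave pair weight at
  arbitrarily small NONZERO momentum along the ground-state sequence — phase separation into paired puddles,
  a sliding pair-density wave `Q_L → 0`) and `not_wibAt_of_pairPeakAt : PairPeakAt U δ → ¬ WibAt U δ`
  (PROVED), with the corollary `not_wib_of_pairPeakAt`. The tree's `not_wib_of_pairPeakWitness` is the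
  `∃ (U,δ)`-form against the whole crux; this is the form a ONE-POINT re-target (`WibAt` at the route's
  point) inherits as its refuter interface.
* §C STRENGTHEN lens, the sub-Landau ("soft pair mode") form: `WibSoft` — the window law claimed only for
  the window modes whose single-mode (Feynman–Bijl) pair-removal / pair-addition energy lies BELOW the
  linear Landau line `c|q|`; `wib_of_wibSoft : WibSoft → WindowInfraredBound` (PROVED from the landed
  engine A `goldstoneShape_of_pairYrastFloor` + `stub_doubleCommBound` + the window lattice sum): the crux
  has NO content outside the sub-Landau pair modes — engine A is sharp.
* §D RE-TARGET candidate for the route planners / tribunal (not a strategist verb): `IsExposed U δ L`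
  (the filling `N_L` lies on a supporting line of the even-`N` sector ground energies of `H_L`, i.e. it is
  a grand-canonical ground sector for some `μ`) and `WibExposed` (the window law claimed only at exposed
  `(U, δ, L)`); `wibExposed_of_wib` (trivial weakening). Phase separation in density makes `N_L`
  non-exposed (interface energy), so `WibExposed` drops exactly the literature-backed refutation surface of
  the `∀ (U, δ)` crux without picking a point.
* §E WHAT THE ROUTE MINIMALLY NEEDS INSTEAD OF THE CRUX (conjunct-split bookkeeping, all one-liners over landed theorems):
  `MesoGivesSummit :≡ MesoscopicPairOrder → HubbardSuperconductivity` is implied by the crux (`mesoGivesSummit_of_wib`, the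
  landed structural assembly reordered) AND by the summit (`mesoGivesSummit_of_summit`), and
  `summit_iff_meso_and_mesoGivesSummit : HubbardSuperconductivity ↔ MesoscopicPairOrder ∧ MesoGivesSummit` (using the landed
  necessity `mesoscopicPairOrder_of_hubbardSuperconductivity`): the route is the conjunct split `S ⟺ Meso ∧ (Meso → S)` whose
  attacked conjunct is `Meso` and whose RESIDUAL is the local-to-global bridge — for which the `∀ (U,δ)` infrared bound was one
  sufficient MECHANISM, over-strong and plausibly false, never a logical necessity. The point-free `∀`-form of the residual,
  `MesoLocalToGlobal` (box order at all scales in every GS ⇒ uniform `k = 0` pair order, at every `(U, δ)`), closes the route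
  with `Meso` (`summit_of_meso_of_mesoLocalToGlobal`, proved) and carries NO Goldstone / infrared content: its only failure mode
  is a ground-state sequence whose pair weight condenses at momenta `Q_L → 0`, `Q_L ≠ 0`, with vanishing `k = 0` component.
-/

namespace Summit.HubbardSuperconductivity.HubbardSuperconductivity.Cruxes.WindowInfraredBound.StrategistR1

set_option linter.dupNamespace false

open Literature.MathematicalPhysics.QuantumLattice Literature.Probability.LatticeModels Matrix Finset
open scoped ComplexOrder ComplexConjugate Classical
open Summit.HubbardSuperconductivity.HubbardSuperconductivity.Theses
open Summit.HubbardSuperconductivity.HubbardSuperconductivity.Theorems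

/-! ## §A The crux body at one point -/

/-- `WibAt U δ`: the body of `WindowInfraredBound` at the point `(U, δ)` (tree vocabulary). -/
def WibAt (U δ : ℝ) : Prop :=
  ∃ C ε₀ : ℝ, 0 ≤ C ∧ 0 < ε₀ ∧ ∃ L₀ : ℕ,
    ∀ ε ∈ Set.Ioc (0:ℝ) ε₀, ∀ (L : ℕ) [NeZero L], L₀ ≤ L → Even L →
      ∀ ψ : Fock (Orb (FermionTorus 2 L)), star ψ ⬝ᵥ ψ = 1 →
        IsGroundStateInSector (hubbardTorus 2 L 1 U) (2 * ⌊(1 - δ) * (L : ℝ) ^ 2 / 2⌋₊) 0 ψ →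
          (∑ m : TorusSite 2 L, if m ≠ 0 ∧ momentumNormSq L m ≤ ε ^ 2 then
              pairStructureFactor dWaveFormFactor L ψ m else 0) ≤ C * ε * (L : ℝ) ^ 2

/-- The crux is `∀ (U, δ), WibAt U δ` (definitional). -/
theorem wib_iff_forall_wibAt :
    FunctionFieldCertificate.WindowInfraredBound ↔ ∀ U : ℝ, 0 < U → ∀ δ ∈ Set.Ioo (0:ℝ) (1 / 2), WibAt U δ :=
  Iff.rfl

/-! ## §B Pointwise refuter interface: a pair peak at vanishing momentum kills `WibAt` -/

/-- `PairPeakAt U δ`: MACROSCOPIC `d`-wave pair weight at arbitrarily small nonzero momentum along the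
ground-state sequence at `(U, δ)`: some `a > 0` such that for every window `ε₀ > 0` and every `L₀` some even
`L ≥ L₀` carries a normalised `(N_L, 0)`-sector ground state `ψ` and a momentum label `m ≠ 0` with
`|q_m| ≤ ε₀` and `S_ψ(m) ≥ a L²` (what phase separation into superconducting puddles, or a pair-density wave
with `|Q_L| → 0`, produces at `|q| ~ 2π/L`). -/
def PairPeakAt (U δ : ℝ) : Prop :=
  ∃ a : ℝ, 0 < a ∧ ∀ ε₀ : ℝ, 0 < ε₀ → ∀ L₀ : ℕ, ∃ (L : ℕ) (_ : NeZero L), L₀ ≤ L ∧ Even L ∧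
    ∃ ψ : Fock (Orb (FermionTorus 2 L)), star ψ ⬝ᵥ ψ = 1 ∧
      IsGroundStateInSector (hubbardTorus 2 L 1 U) (2 * ⌊(1 - δ) * (L : ℝ) ^ 2 / 2⌋₊) 0 ψ ∧
        ∃ m : TorusSite 2 L, m ≠ 0 ∧ momentumNormSq L m ≤ ε₀ ^ 2 ∧
          a * (L : ℝ) ^ 2 ≤ pairStructureFactor dWaveFormFactor L ψ m

/-- **A pair peak at vanishing momentum refutes the window law at that point.** Given the constants
`C, ε₀, L₀` of `WibAt U δ`, pick the peak with window `ε₁ := min ε₀ (a/(2(C+1)))` beyond `L₀` and test the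
window law at `ε := |q_m| ≤ ε₁`: the window sum contains `S_ψ(m) ≥ aL²`, but `CεL² ≤ C·a/(2(C+1))·L² < aL²`.
[folklore] -/
theorem not_wibAt_of_pairPeakAt {U δ : ℝ} (h : PairPeakAt U δ) : ¬ WibAt U δ := by
  rintro ⟨C, ε₀, hC, hε₀, L₀, hB⟩
  obtain ⟨a, ha, hpk⟩ := h
  set ε₁ : ℝ := min ε₀ (a / (2 * (C + 1))) with hε₁
  have hε₁pos : 0 < ε₁ := lt_min hε₀ (by positivity)
  obtain ⟨L, _, hL₀, hev, ψ, hψ1, hψ, m, hm0, hmε₁, hpeak⟩ := hpk ε₁ hε₁pos L₀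
  have hpos : 0 < momentumNormSq L m :=
    (momentumNormSq_nonneg m).lt_of_ne' (fun h0 => hm0 ((momentumNormSq_eq_zero_iff m).1 h0))
  set ε : ℝ := Real.sqrt (momentumNormSq L m) with hε
  have hεpos : 0 < ε := Real.sqrt_pos.2 hpos
  have hεsq : ε ^ 2 = momentumNormSq L m := Real.sq_sqrt hpos.le
  have hεε₁ : ε ≤ ε₁ := by
    rw [hε, ← Real.sqrt_sq hε₁pos.le]
    exact Real.sqrt_le_sqrt hmε₁
  have hεε₀ : ε ≤ ε₀ := hεε₁.trans (min_le_left _ _)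
  have hsum := hB ε ⟨hεpos, hεε₀⟩ L hL₀ hev ψ hψ1 hψ
  -- the window sum at `ε = |q_m|` contains the term `m`
  have hterm : pairStructureFactor dWaveFormFactor L ψ m ≤
      ∑ m' : TorusSite 2 L, if m' ≠ 0 ∧ momentumNormSq L m' ≤ ε ^ 2 then
        pairStructureFactor dWaveFormFactor L ψ m' else 0 := by
    have hm : (if m ≠ 0 ∧ momentumNormSq L m ≤ ε ^ 2 then
        pairStructureFactor dWaveFormFactor L ψ m else 0) =
        pairStructureFactor dWaveFormFactor L ψ m := if_pos ⟨hm0, hεsq.symm.le⟩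
    rw [← hm]
    exact Finset.single_le_sum (f := fun m' => if m' ≠ 0 ∧ momentumNormSq L m' ≤ ε ^ 2 then
        pairStructureFactor dWaveFormFactor L ψ m' else 0)
      (fun m' _ => by
        split_ifs
        exacts [pairStructureFactor_nonneg _ _ _ _, le_rfl])
      (Finset.mem_univ m)
  -- `C ε L² < a L²`
  have hL : (0 : ℝ) < (L : ℝ) ^ 2 := by
    have : (0 : ℝ) < L := Nat.cast_pos.2 (Nat.pos_of_ne_zero (NeZero.ne L))
    positivity
  have hCε : C * ε < a := by
    have h1 : ε ≤ a / (2 * (C + 1)) := hεε₁.trans (min_le_right _ _)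
    have h2 : C * ε ≤ C * (a / (2 * (C + 1))) := mul_le_mul_of_nonneg_left h1 hC
    have h3 : C * (a / (2 * (C + 1))) < a := by
      rw [mul_div_assoc', div_lt_iff₀ (by positivity)]
      nlinarith
    linarith
  have hlt : C * ε * (L : ℝ) ^ 2 < a * (L : ℝ) ^ 2 := mul_lt_mul_of_pos_right hCε hL
  linarith [hterm, hsum, hpeak]

/-- Corollary: a pair peak at ONE `(U, δ)` refutes the `∀ (U, δ)` crux. [folklore] -/
theorem not_wib_of_pairPeakAt {U δ : ℝ} (hU : 0 < U) (hδ : δ ∈ Set.Ioo (0:ℝ) (1 / 2))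
    (h : PairPeakAt U δ) : ¬ FunctionFieldCertificate.WindowInfraredBound := by
  rw [wib_iff_forall_wibAt]
  exact fun hW => not_wibAt_of_pairPeakAt h (hW U hU δ hδ)

/-! ## §C The sub-Landau (soft pair mode) form of the crux, and its sufficiency -/

/-- `IsSoftPairMode L U c μ' ψ m`: at the state `ψ`, the pair mode of momentum label `m` is SOFTER THAN
LINEAR — the Rayleigh quotient of `K = H - μ'N̂` at the pair-removal vector `Δ_d(m)ψ` or at the
pair-addition vector `Δ_d(m)ᴴψ` lies strictly below `E + c|q_m|`, `E = Re⟨ψ, Kψ⟩` (for a normalised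
`K`-eigenvector, its eigenvalue). Its negation is exactly the two-sided linear Landau floor `hY` of
engine A (`goldstoneShape_of_pairYrastFloor`). -/
def IsSoftPairMode (L : ℕ) [NeZero L] (U c μ' : ℝ) (ψ : Fock (Orb (FermionTorus 2 L)))
    (m : TorusSite 2 L) : Prop :=
  (star (pairFieldAt dWaveFormFactor L m *ᵥ ψ) ⬝ᵥ
      (hubbardTorusWith 2 L 1 U μ' *ᵥ (pairFieldAt dWaveFormFactor L m *ᵥ ψ))).re <
    ((star ψ ⬝ᵥ (hubbardTorusWith 2 L 1 U μ' *ᵥ ψ)).re + c * Real.sqrt (momentumNormSq L m)) *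
      (star (pairFieldAt dWaveFormFactor L m *ᵥ ψ) ⬝ᵥ (pairFieldAt dWaveFormFactor L m *ᵥ ψ)).re ∨
  (star ((pairFieldAt dWaveFormFactor L m)ᴴ *ᵥ ψ) ⬝ᵥ
      (hubbardTorusWith 2 L 1 U μ' *ᵥ ((pairFieldAt dWaveFormFactor L m)ᴴ *ᵥ ψ))).re <
    ((star ψ ⬝ᵥ (hubbardTorusWith 2 L 1 U μ' *ᵥ ψ)).re + c * Real.sqrt (momentumNormSq L m)) *
      (star ((pairFieldAt dWaveFormFactor L m)ᴴ *ᵥ ψ) ⬝ᵥ ((pairFieldAt dWaveFormFactor L m)ᴴ *ᵥ ψ)).re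

/-- `WibSoft`: the window law claimed ONLY for the sub-Landau pair modes — for all `(U, δ)` there are a
Landau slope `c > 0`, constants `C, ε₀, M₀, L₀` such that in every normalised sector ground state, for some
chemical potential `|μ'| ≤ M₀`, the window pair weight carried by the SOFT modes is `≤ C ε L²`. -/
def WibSoft : Prop :=
  ∀ U : ℝ, 0 < U → ∀ δ ∈ Set.Ioo (0:ℝ) (1 / 2), ∃ c C ε₀ M₀ : ℝ, 0 < c ∧ 0 ≤ C ∧ 0 < ε₀ ∧ ∃ L₀ : ℕ,
    ∀ ε ∈ Set.Ioc (0:ℝ) ε₀, ∀ (L : ℕ) [NeZero L], L₀ ≤ L → Even L →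
      ∀ ψ : Fock (Orb (FermionTorus 2 L)), star ψ ⬝ᵥ ψ = 1 →
        IsGroundStateInSector (hubbardTorus 2 L 1 U) (2 * ⌊(1 - δ) * (L : ℝ) ^ 2 / 2⌋₊) 0 ψ →
          ∃ μ' : ℝ, |μ'| ≤ M₀ ∧
            (∑ m : TorusSite 2 L, if m ≠ 0 ∧ momentumNormSq L m ≤ ε ^ 2 then
                (if IsSoftPairMode L U c μ' ψ m then pairStructureFactor dWaveFormFactor L ψ m else 0)
              else 0) ≤ C * ε * (L : ℝ) ^ 2

/-- For a normalised eigenvector the Rayleigh quotient is the eigenvalue. [folklore] -/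
theorem re_rayleigh_of_eigen {n : Type*} [Fintype n] {K : Matrix n n ℂ} {ψ : n → ℂ} {E : ℝ}
    (h : K *ᵥ ψ = (E : ℂ) • ψ) (h1 : star ψ ⬝ᵥ ψ = 1) : (star ψ ⬝ᵥ (K *ᵥ ψ)).re = E := by
  rw [h, dotProduct_smul, h1, smul_eq_mul, mul_one, Complex.ofReal_re]

/-- **Engine A is sharp: the sub-Landau form implies the crux.** Outside the soft modes both Landau
floors hold, so engine A (`goldstoneShape_of_pairYrastFloor` with the landed `stub_doubleCommBound`)
gives the Goldstone shape `S_ψ(m)·|q_m| ≤ C_B(1+|M₀|)/c` there, and the window lattice sum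
(`wls_window_sum_le` at `α = 1`) bounds their total by `32·(C_B(1+|M₀|)/c)·εL²`; the soft modes are the
hypothesis. Constant: `C + 32 C_B (1 + |M₀|)/c`. [folklore] -/
theorem wib_of_wibSoft (h : WibSoft) : FunctionFieldCertificate.WindowInfraredBound := by
  rw [wib_iff_pairStructureFactor]
  intro U hU δ hδ
  obtain ⟨c, C, ε₀, M₀, hc, hC, hε₀, L₀, hS⟩ := h U hU δ hδ
  obtain ⟨CB, hCB, hB⟩ := stub_doubleCommBound U hU
  set A : ℝ := CB * (1 + |M₀|) / c with hA
  have hA0 : 0 ≤ A := by positivity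
  refine ⟨C + 32 * A, ε₀, by positivity, hε₀, L₀, fun ε hε L _ hL₀ hev ψ hψ1 hψ => ?_⟩
  obtain ⟨μ', hμ', hsoft⟩ := hS ε hε L hL₀ hev ψ hψ1 hψ
  have hL : (0 : ℝ) < (L : ℝ) ^ 2 := by
    have : (0 : ℝ) < L := Nat.cast_pos.2 (Nat.pos_of_ne_zero (NeZero.ne L))
    positivity
  -- pointwise: every window mode is either soft (hypothesis) or has the Goldstone shape (engine A)
  have hpt : ∀ m : TorusSite 2 L,
      (if m ≠ 0 ∧ momentumNormSq L m ≤ ε ^ 2 then pairStructureFactor dWaveFormFactor L ψ m else 0) ≤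
        (if m ≠ 0 ∧ momentumNormSq L m ≤ ε ^ 2 then
            (if IsSoftPairMode L U c μ' ψ m then pairStructureFactor dWaveFormFactor L ψ m else 0)
          else 0) +
        (if m ≠ 0 ∧ momentumNormSq L m < (2 * ε) ^ 2 then
            A * (momentumNormSq L m ^ ((1:ℝ) / 2))⁻¹ else 0) := by
    intro m
    have hinv : 0 ≤ A * (momentumNormSq L m ^ ((1:ℝ) / 2))⁻¹ :=
      mul_nonneg hA0 (inv_nonneg.2 (Real.rpow_nonneg (momentumNormSq_nonneg m) _))
    by_cases hw : m ≠ 0 ∧ momentumNormSq L m ≤ ε ^ 2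
    · rw [if_pos hw, if_pos hw]
      have hw' : m ≠ 0 ∧ momentumNormSq L m < (2 * ε) ^ 2 :=
        ⟨hw.1, lt_of_le_of_lt hw.2 (by nlinarith [hε.1])⟩
      rw [if_pos hw']
      by_cases hsm : IsSoftPairMode L U c μ' ψ m
      · rw [if_pos hsm]
        linarith
      · rw [if_neg hsm, zero_add]
        have hpos : 0 < momentumNormSq L m :=
          (momentumNormSq_nonneg m).lt_of_ne' (fun h0 => hw.1 ((momentumNormSq_eq_zero_iff m).1 h0))
        have hsq : 0 < Real.sqrt (momentumNormSq L m) := Real.sqrt_pos.2 hpos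
        -- the two Landau floors at the eigenvalue
        have hfl : ∀ E : ℝ, hubbardTorusWith 2 L 1 U μ' *ᵥ ψ = (E : ℂ) • ψ →
            (E + c * Real.sqrt (momentumNormSq L m)) *
                (star (pairFieldAt dWaveFormFactor L m *ᵥ ψ) ⬝ᵥ
                  (pairFieldAt dWaveFormFactor L m *ᵥ ψ)).re ≤
              (star (pairFieldAt dWaveFormFactor L m *ᵥ ψ) ⬝ᵥ
                (hubbardTorusWith 2 L 1 U μ' *ᵥ (pairFieldAt dWaveFormFactor L m *ᵥ ψ))).re ∧
            (E + c * Real.sqrt (momentumNormSq L m)) *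
                (star ((pairFieldAt dWaveFormFactor L m)ᴴ *ᵥ ψ) ⬝ᵥ
                  ((pairFieldAt dWaveFormFactor L m)ᴴ *ᵥ ψ)).re ≤
              (star ((pairFieldAt dWaveFormFactor L m)ᴴ *ᵥ ψ) ⬝ᵥ
                (hubbardTorusWith 2 L 1 U μ' *ᵥ ((pairFieldAt dWaveFormFactor L m)ᴴ *ᵥ ψ))).re := by
          intro E hE
          have hE' := re_rayleigh_of_eigen hE hψ1
          simp only [IsSoftPairMode, not_or, not_lt] at hsm
          rw [hE'] at hsm
          exact hsm
        have key := goldstoneShape_of_pairYrastFloor hψ hψ1 hc hw.1 (hB L μ' m ψ) hfl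
        -- `C_B (1 + |μ'|)/c ≤ A`
        have hkeyA : pairStructureFactor dWaveFormFactor L ψ m * Real.sqrt (momentumNormSq L m) ≤ A := by
          refine key.trans ?_
          rw [hA]
          refine div_le_div_of_nonneg_right ?_ hc.le
          exact mul_le_mul_of_nonneg_left (by linarith [hμ', le_abs_self M₀]) hCB
        have hshape : pairStructureFactor dWaveFormFactor L ψ m ≤
            A * (momentumNormSq L m ^ ((1:ℝ) / 2))⁻¹ := by
          rw [← Real.sqrt_eq_rpow, le_mul_inv_iff₀ hsq]
          exact hkeyA
        exact hshape
    · rw [if_neg hw, if_neg hw, zero_add]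
      split_ifs
      · exact hinv
      · exact le_rfl
  -- the Goldstone-shaped part: window lattice sum
  set W' := Finset.univ.filter (fun m : TorusSite 2 L => m ≠ 0 ∧ momentumNormSq L m < (2 * ε) ^ 2)
    with hW'
  have hlat := wls_window_sum_le (α := (1:ℝ)) zero_le_one one_lt_two
    (by linarith [hε.1] : (0:ℝ) < 2 * ε) L
  have hconst : 8 * (1 + 1 / (2 - (1:ℝ))) * (2 * ε) ^ ((2:ℝ) - 1) * (L : ℝ) ^ 2 =
      32 * ε * (L : ℝ) ^ 2 := by
    rw [show (2:ℝ) - 1 = 1 by norm_num, Real.rpow_one]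
    ring
  rw [hconst] at hlat
  have hshapeSum : (∑ m : TorusSite 2 L, if m ≠ 0 ∧ momentumNormSq L m < (2 * ε) ^ 2 then
        A * (momentumNormSq L m ^ ((1:ℝ) / 2))⁻¹ else 0) ≤ 32 * A * ε * (L : ℝ) ^ 2 := by
    rw [← Finset.sum_filter, ← Finset.mul_sum]
    calc A * ∑ m ∈ W', (momentumNormSq L m ^ ((1:ℝ) / 2))⁻¹
        ≤ A * (32 * ε * (L : ℝ) ^ 2) := mul_le_mul_of_nonneg_left hlat hA0
      _ = 32 * A * ε * (L : ℝ) ^ 2 := by ring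
  calc (∑ m : TorusSite 2 L, if m ≠ 0 ∧ momentumNormSq L m ≤ ε ^ 2 then
          pairStructureFactor dWaveFormFactor L ψ m else 0)
      ≤ ∑ m : TorusSite 2 L,
          ((if m ≠ 0 ∧ momentumNormSq L m ≤ ε ^ 2 then
              (if IsSoftPairMode L U c μ' ψ m then pairStructureFactor dWaveFormFactor L ψ m else 0)
            else 0) +
          (if m ≠ 0 ∧ momentumNormSq L m < (2 * ε) ^ 2 then
              A * (momentumNormSq L m ^ ((1:ℝ) / 2))⁻¹ else 0)) := Finset.sum_le_sum fun m _ => hpt m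
    _ = (∑ m : TorusSite 2 L, (if m ≠ 0 ∧ momentumNormSq L m ≤ ε ^ 2 then
              (if IsSoftPairMode L U c μ' ψ m then pairStructureFactor dWaveFormFactor L ψ m else 0)
            else 0)) +
        ∑ m : TorusSite 2 L, (if m ≠ 0 ∧ momentumNormSq L m < (2 * ε) ^ 2 then
              A * (momentumNormSq L m ^ ((1:ℝ) / 2))⁻¹ else 0) := Finset.sum_add_distrib
    _ ≤ C * ε * (L : ℝ) ^ 2 + 32 * A * ε * (L : ℝ) ^ 2 := add_le_add hsoft hshapeSum
    _ = (C + 32 * A) * ε * (L : ℝ) ^ 2 := by ring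

/-- Converse bookkeeping: the crux gives the sub-Landau form (every sub-sum of the window sum is bounded by
the window sum; `c := 1`, `μ' := 0`). So `WibSoft ↔ WindowInfraredBound`: an EQUIVALENT SHAPE, not a new
lever — its use is negative: any future line must bound the weight of pair modes SOFTER than linear, and
the only known mechanisms producing such modes (sliding condensates, paired phase separation, domain-wall
translation) are the refutation surface itself. [folklore] -/
theorem wibSoft_of_wib (h : FunctionFieldCertificate.WindowInfraredBound) : WibSoft := by
  rw [wib_iff_pairStructureFactor] at h
  intro U hU δ hδ
  obtain ⟨C, ε₀, hC, hε₀, L₀, hW⟩ := h U hU δ hδ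
  refine ⟨1, C, ε₀, 0, one_pos, hC, hε₀, L₀, fun ε hε L _ hL₀ hev ψ hψ1 hψ => ⟨0, by simp, ?_⟩⟩
  refine le_trans (Finset.sum_le_sum fun m _ => ?_) (hW ε hε L hL₀ hev ψ hψ1 hψ)
  split_ifs
  · exact le_rfl
  · exact pairStructureFactor_nonneg _ _ _ _
  · exact le_rfl

/-! ## §D Re-target candidate (route planners / tribunal): the window law at EXPOSED fillings only -/

/-- `IsExposed U δ L`: the summit filling `N_L = 2⌊(1-δ)L²/2⌋` is EXPOSED for `H_L = hubbardTorus 2 L 1 U`: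
some chemical potential `μ` supports the even-`N` sector ground energies at `N_L`, i.e.
`E₀(N_L) - μ N_L ≤ E₀(N) - μ N` for every even `N ≤ 2L²` (`E₀(N) = minEnergyOn (szSector N 0)`; the range
restriction avoids the junk value of `minEnergyOn` on empty sectors). Equivalently: the `(N_L, 0)` sector
ground states are grand-canonical ground states of `H_L - μN̂` on `S^z = 0`. Phase separation in density
at `(U, δ)` (energy above the Maxwell line by the interface cost) makes `N_L` NON-exposed for large `L`. -/
def IsExposed (U δ : ℝ) (L : ℕ) [NeZero L] : Prop :=
  ∃ μ : ℝ, ∀ N : ℕ, Even N → N ≤ 2 * L ^ 2 →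
    (hubbardTorus 2 L 1 U).minEnergyOn
          (szSector (Λ := FermionTorus 2 L) (2 * ⌊(1 - δ) * (L : ℝ) ^ 2 / 2⌋₊) 0) -
        μ * ((2 * ⌊(1 - δ) * (L : ℝ) ^ 2 / 2⌋₊ : ℕ) : ℝ) ≤
      (hubbardTorus 2 L 1 U).minEnergyOn (szSector (Λ := FermionTorus 2 L) N 0) - μ * (N : ℝ)

/-- `WibExposed`: the window infrared bound claimed only along the exposed volumes — for all `(U, δ)` there
are `C, ε₀, L₀` such that for every `ε ≤ ε₀`, every even `L ≥ L₀` AT WHICH `N_L` IS EXPOSED, and every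
normalised `(N_L, 0)`-sector ground state, `T_ε(ψ) ≤ C ε L²`. Plausibly TRUE at every `(U, δ)` (homogeneous
superconductor: Goldstone `1/|q|`; metal / stripes: flat), because the paired-phase-separation scenario that
makes the `∀ (U, δ)` crux plausibly FALSE at `U ≲ 4`, `δ ≲ 0.1` is excluded by exposure; still an RP-free
`T = 0` infrared bound with no engine in print (open-problem class). A route consuming it needs exposure at
its own point as a separate (energy-convexity) hypothesis. NOT filed by this seat (route-level decision). -/
def WibExposed : Prop :=
  ∀ U : ℝ, 0 < U → ∀ δ ∈ Set.Ioo (0:ℝ) (1 / 2), ∃ C ε₀ : ℝ, 0 ≤ C ∧ 0 < ε₀ ∧ ∃ L₀ : ℕ,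
    ∀ ε ∈ Set.Ioc (0:ℝ) ε₀, ∀ (L : ℕ) [NeZero L], L₀ ≤ L → Even L → IsExposed U δ L →
      ∀ ψ : Fock (Orb (FermionTorus 2 L)), star ψ ⬝ᵥ ψ = 1 →
        IsGroundStateInSector (hubbardTorus 2 L 1 U) (2 * ⌊(1 - δ) * (L : ℝ) ^ 2 / 2⌋₊) 0 ψ →
          (∑ m : TorusSite 2 L, if m ≠ 0 ∧ momentumNormSq L m ≤ ε ^ 2 then
              pairStructureFactor dWaveFormFactor L ψ m else 0) ≤ C * ε * (L : ℝ) ^ 2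

/-- The crux implies its exposed restriction (drop the exposure hypothesis). [folklore] -/
theorem wibExposed_of_wib (h : FunctionFieldCertificate.WindowInfraredBound) : WibExposed := by
  rw [wib_iff_pairStructureFactor] at h
  intro U hU δ hδ
  obtain ⟨C, ε₀, hC, hε₀, L₀, hW⟩ := h U hU δ hδ
  exact ⟨C, ε₀, hC, hε₀, L₀, fun ε hε L _ hL₀ hev _ ψ hψ1 hψ => hW ε hε L hL₀ hev ψ hψ1 hψ⟩

/-! ## §E What route `FunctionFieldCertificate` minimally needs in place of the crux -/

/-- `MesoGivesSummit`: the minimal complement of the route's other crux — the local-to-global bridge as a bare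
implication. -/
def MesoGivesSummit : Prop :=
  FunctionFieldCertificate.MesoscopicPairOrder → _root_.HubbardSuperconductivity

/-- The crux implies the bridge (the landed structural assembly, reordered): replacing the crux by the bridge
loses nothing for the route. [folklore] -/
theorem mesoGivesSummit_of_wib (hW : FunctionFieldCertificate.WindowInfraredBound) : MesoGivesSummit :=
  fun hM => functionFieldCertificate_assembly_structural hM hW

/-- The summit implies the bridge (trivially): the bridge is a CONSEQUENCE of `S`, unlike the crux. [folklore] -/
theorem mesoGivesSummit_of_summit (hS : _root_.HubbardSuperconductivity) : MesoGivesSummit := fun _ => hS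

/-- **Conjunct split.** With the landed necessity `mesoscopicPairOrder_of_hubbardSuperconductivity` (`S → Meso`):
`S ↔ Meso ∧ (Meso → S)` — the route attacks `Meso`; the residual is the bridge. [folklore] -/
theorem summit_iff_meso_and_mesoGivesSummit :
    _root_.HubbardSuperconductivity ↔ (FunctionFieldCertificate.MesoscopicPairOrder ∧ MesoGivesSummit) :=
  ⟨fun hS => ⟨FunctionFieldCertificate.mesoscopicPairOrder_of_hubbardSuperconductivity hS, fun _ => hS⟩,
    fun h => h.2 h.1⟩

/-- `MesoLocalToGlobal`: the point-free `∀`-form of the residual — at every `(U, δ)` and every margin `m > 0`, IF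
every normalised `(N_L,0)`-sector ground state has Fejér-box `d`-wave pair order `≥ m R²` at arbitrarily large
block scales `R` (the body of `MesoscopicPairOrder` at that point, verbatim), THEN the ground states have UNIFORM
`k = 0` pair order: some `a > 0` with `a L⁴ ≤ Re⟨ψ, Δ_dᴴΔ_d ψ⟩` for every such `ψ` at all large even `L`. No window,
no rate, no Goldstone shape: box order at all mesoscopic scales without `k = 0` order requires the pair weight of a
ground-state sequence to condense at NONZERO momenta `Q_L → 0` with no uniform component (a sliding pair-density
wave) — phase separation into paired puddles does NOT violate it (it has `k = 0` weight `(λa)²`). -/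
def MesoLocalToGlobal : Prop :=
  ∀ U : ℝ, 0 < U → ∀ δ ∈ Set.Ioo (0:ℝ) (1 / 2), ∀ m : ℝ, 0 < m →
    (∀ R₀ : ℕ, ∃ R : ℕ, R₀ ≤ R ∧ ∃ L₀ : ℕ, ∀ (L : ℕ) [NeZero L], L₀ ≤ L → Even L →
      ∀ ψ : Fock (Orb (FermionTorus 2 L)), star ψ ⬝ᵥ ψ = 1 →
        IsGroundStateInSector (hubbardTorus 2 L 1 U) (2 * ⌊(1 - δ) * (L : ℝ) ^ 2 / 2⌋₊) 0 ψ →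
          m * (R : ℝ) ^ 2 ≤ (∑ x : Fin 2 → ZMod L, ∑ y : Fin 2 → ZMod L,
            (∏ i : Fin 2, max 0 (1 - |(((y i - x i).valMinAbs : ℤ) : ℝ)| / (R : ℝ))) *
              (star (Matrix.mulVec (localPair dWaveFormFactor L x) ψ) ⬝ᵥ
                Matrix.mulVec (localPair dWaveFormFactor L y) ψ).re) / (L : ℝ) ^ 2) →
    ∃ a : ℝ, 0 < a ∧ ∃ L₀ : ℕ, ∀ (L : ℕ) [NeZero L], L₀ ≤ L → Even L →
      ∀ ψ : Fock (Orb (FermionTorus 2 L)),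
        IsGroundStateInSector (hubbardTorus 2 L 1 U) (2 * ⌊(1 - δ) * (L : ℝ) ^ 2 / 2⌋₊) 0 ψ →
          star ψ ⬝ᵥ ψ = 1 →
            a * (L : ℝ) ^ 4 ≤ (star ψ ⬝ᵥ ((pairField dWaveFormFactor L)ᴴ * pairField dWaveFormFactor L) *ᵥ ψ).re

/-- The point-free residual gives the bare bridge, hence closes the route with `Meso`
(`hasLRO_of_uniform_groundState_bound` of the structural assembly does the `liminf` bookkeeping). [folklore] -/
theorem mesoGivesSummit_of_mesoLocalToGlobal (h : MesoLocalToGlobal) : MesoGivesSummit := by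
  rintro ⟨U, hU, δ, hδ, m, hm, hMeso⟩
  obtain ⟨a, ha, L₀, hb⟩ := h U hU δ hδ m hm hMeso
  exact ⟨U, hU, δ, hδ, fun N ψ hadm =>
    FunctionFieldCertificateAssemblyStructural.hasLRO_of_uniform_groundState_bound dWaveFormFactor
      (fun L => hubbardTorus 2 L 1 U) (fun L => 2 * ⌊(1 - δ) * (L : ℝ) ^ 2 / 2⌋₊) 0 a ha L₀
      (fun L _ hL hE ψ hgs hψ1 => hb L hL hE ψ hgs hψ1) N ψ hadm⟩

/-- The candidate deciding theorem for a re-targeted route: `Meso` and the point-free residual give the summit. [folklore] -/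
theorem summit_of_meso_of_mesoLocalToGlobal (hM : FunctionFieldCertificate.MesoscopicPairOrder)
    (hL : MesoLocalToGlobal) : _root_.HubbardSuperconductivity :=
  mesoGivesSummit_of_mesoLocalToGlobal hL hM

end Summit.HubbardSuperconductivity.HubbardSuperconductivity.Cruxes.WindowInfraredBound.StrategistR1
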